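import Mathlib

/-!
# SoloBlindTransposeSymmetry — the transpose symmetry of the isospectral cone (Remark 18.15)

solo `solo-MatrixMultiplication-blind`, LieExponent §3.34 (door L: the BCGPU Lie-group TPP programme read as a
barrier; no bearing on `ω = 2` is claimed).

For a SYMMETRIC base point `p` (in the application `p = diag(0,1,3,7)`), matrix transposition `e ↦ eᵀ`
 * preserves isospectrality of the pencil: `χ(p + s eᵀ) = χ(p + s e)` for every `s`
   (`soloLie_transpose_isospectral`), so it is a linear automorphism of the isospectral cone `𝓛(p)`;
 * maps the closed-form family of Theorem 18.6 with data `(k, w, k̃, w̃, ρ)`,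
   `e = ρ [k wᵀ, p] + w̃ k̃ᵀ` (correction block on `J × I`, `supp k̃ ⊆ I`, `supp w̃ ⊆ J`),
   onto the family with data `(w, k, w̃, k̃, -ρ)` (correction block on `I × J`)
   (`soloLie_transpose_family`), and exchanges the two rank-one-type side conditions
   `wᵀ k = 0`, `wᵀ p k = 0` (`soloLie_transpose_conditions`); the conditions `k̃ᵀ k = 0`, `w̃ᵀ w = 0`
   are exchanged verbatim.
Hence `Z_{I,J}ᵀ = Z_{J,I}` and `deg Z_{J,I} = deg Z_{I,J}` — the step that completes THEOREM 18.10(D)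
(the two families certified at 35 points, `Z_{13,02}` and `Z_{12,03}`, are the transposes of `Z_{02,13}` and
`Z_{03,12}`, certified at 36).  `soloLie_witness_transpose` is the concrete instance: the transpose of the
integral witness `e* ∈ Z_{01,23}` of Theorem 18.6(ii) written in the `Z_{23,01}` closed form.
Mathlib only; standard axioms.
-/

namespace Summit.MatrixMultiplication.MatrixMultiplication.Theorems

open Matrix

section general

variable {n : Type*} [Fintype n] {R : Type*} [CommRing R]

/-- Transposition preserves isospectrality of a pencil through a symmetric base point. -/
theorem soloLie_transpose_isospectral [DecidableEq n] (p e : Matrix n n R) (hp : pᵀ = p) (s : R) :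
    (p + s • eᵀ).charpoly = (p + s • e).charpoly := by
  have h : p + s • eᵀ = (p + s • e)ᵀ := by
    rw [transpose_add, transpose_smul, hp]
  rw [h, Matrix.charpoly_transpose]

/-- Transposition maps the `Z_{I,J}` closed form with data `(k, w, k̃, w̃, ρ)` to the `Z_{J,I}` closed form
with data `(w, k, w̃, k̃, -ρ)`:  `(ρ[k wᵀ, p] + w̃ k̃ᵀ)ᵀ = (-ρ)[w kᵀ, p] + k̃ w̃ᵀ` for symmetric `p`. -/
theorem soloLie_transpose_family (p : Matrix n n R) (hp : pᵀ = p) (k w kt wt : n → R) (ρ : R) :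
    (ρ • (vecMulVec k w * p - p * vecMulVec k w) + vecMulVec wt kt)ᵀ
      = (-ρ) • (vecMulVec w k * p - p * vecMulVec w k) + vecMulVec kt wt := by
  rw [transpose_add, transpose_smul, transpose_sub, transpose_mul, transpose_mul, transpose_vecMulVec,
    transpose_vecMulVec, hp, neg_smul, ← smul_neg, neg_sub]

/-- The rank-one-type side conditions `wᵀk = 0`, `wᵀ p k = 0` of Theorem 18.6 are symmetric in `(k, w)`
when `p` is symmetric. -/
theorem soloLie_transpose_conditions (p : Matrix n n R) (hp : pᵀ = p) (k w : n → R)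
    (h1 : w ⬝ᵥ k = 0) (h2 : w ⬝ᵥ (p *ᵥ k) = 0) :
    k ⬝ᵥ w = 0 ∧ k ⬝ᵥ (p *ᵥ w) = 0 := by
  refine ⟨by rw [dotProduct_comm]; exact h1, ?_⟩
  rw [dotProduct_mulVec, dotProduct_comm, ← mulVec_transpose, hp]
  exact h2

end general

/-- Concrete instance at `p₀ = diag(0,1,3,7)`: the transpose of the witness
`e* = [k wᵀ, p₀] + w̃ k̃ᵀ ∈ Z_{01,23}` (`k = (1,1,1,1)`, `w = (8,-10,1,1)`, `k̃ = (1,-1,0,0)`, `w̃ = (0,0,1,-1)`)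
is `(-1)[w kᵀ, p₀] + k̃ w̃ᵀ`, a point of the `Z_{23,01}` closed form. -/
theorem soloLie_witness_transpose :
    (!![(0:ℚ), -10, 3, 7; -8, 0, 2, 6; -23, 19, 0, 4; -57, 61, -4, 0] : Matrix (Fin 4) (Fin 4) ℚ)ᵀ
      = (-1 : ℚ) • (vecMulVec ![(8:ℚ), -10, 1, 1] ![(1:ℚ), 1, 1, 1]
              * !![(0:ℚ), 0, 0, 0; 0, 1, 0, 0; 0, 0, 3, 0; 0, 0, 0, 7]
            - !![(0:ℚ), 0, 0, 0; 0, 1, 0, 0; 0, 0, 3, 0; 0, 0, 0, 7]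
              * vecMulVec ![(8:ℚ), -10, 1, 1] ![(1:ℚ), 1, 1, 1])
        + vecMulVec ![(1:ℚ), -1, 0, 0] ![(0:ℚ), 0, 1, -1] := by
  ext i j
  fin_cases i <;> fin_cases j <;>
    simp [Matrix.mul_apply, Fin.sum_univ_four, transpose_apply, Matrix.vecHead, Matrix.vecTail] <;>
    norm_num

end Summit.MatrixMultiplication.MatrixMultiplication.Theorems
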